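import Summits.QuantumFields.BalabanUV.Beta.EriceRemainderEnclosureHistoryAutonomyComparisonAgeCompositionOldPairCapWide

/-!
# EriceRemainderEnclosureHistoryAutonomyComparisonAgeCompositionYoungPairLeaf — (E110b) route (N), first order: THE PAIR-CAP LEAF FOR ANY AGE FLOOR.
# (E102c) `old_pair_leaf` certifies one box `(k∕j ∈ [F₁,F₂], σ = h_{m+j}∕h_{m+k} ∈ [σ₁,σ₂])` of the two-letter pair polytope for OLD ages `56 ≤ j < k`:
# the own-window constant `c = 407∕500` (`c²(3j+1) ≤ 2j` at `j ≥ 56`), the lattice corrections `1∕56`, `57∕56` of the ray constants and the split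
# granularity `θlo·56 + 1 ≤ θ·56` are frozen at the floor `56`.  This file frees the floor: **`young_pair_leaf`** is the same leaf for ages
# `j₀ ≤ j < k` with ANY `j₀ ≥ 1`, own-window constant `c` with `c²(3j₀+1) ≤ 2j₀` (monotone in the age, (E102b) `own_const_mono`), ray constants
# `c_T²(2+θ+1∕j₀) ≤ 2`, `c_b²(2F₁+(j₀+1)∕j₀) ≤ 2F₁`, deficit product against `κ = 2c`, and the split length `T = ⌊θj⌋` controlled either by
# `θlo·j₀ + 1 ≤ θ·j₀` or by `θlo = 0` (the unsplit K letter of (E99a), `θ = 0` allowed).  With `j₀ = 2` the sequel (E110c) certifies the YOUNG-PAIR CAP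
# `x_j + x_k ≤ 43∕50` for `2 ≤ j < k ≤ 58j` (30 boxes; two-letter LP value `0.66–0.81`), which is what the tower's young end needs (`0.86·(1+0.143) ≤ 1`).

Cell `pub-balaban`, β-function sub-cell, BINDER row D4 «RemainderConst leaves for Bałaban's split» (`HOME/BINDER-OWNERS.md`; owner lineage `b2b-balaban-beta-an4`;
this file by co-owner #2 lineage `b2b-balaban-beta-d4-p2`, generation 91), β-FLOW TEAM duty (1), FREEZE (0) honoured (def-free; nothing restated).

HONEST FRAMING (page 1, verbatim and binding).  *"Discharging BetaPertH makes Bałaban's UV stability UNCONDITIONAL — a real constructive-QFT result; it is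
NOT the continuum limit and NOT the Clay problem."*  THIS FILE DISCHARGES NOTHING OF THE KIND.  Elementary real algebra ∕ real analysis about ABSTRACT
functionals on a box ]0,γ]^ℕ with displayed floors, profiles and signs, and the FIRST-ORDER renewal objects of route (N) built from them — hypotheses of a
census, not facts; the form, signs, ages and moments of Bałaban's (1.22) limit functional are NOT PRINTED ([I] p. 298; GAPS G-t4-U2-1∕-2) and NOT asserted.
Row D4 class UNCHANGED (critical-path width 0; instance 0∕1; D4 DISCHARGE NO DATE).  HONEST DEPENDENCY: continuum YM on T⁴ ⇐ BetaPertH ∧ nine spine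
estimates (0/9 proved); BetaPertH ⇐ (D1) ∧ (D4) ∧ CAP+tail; G-an2-4 gates asym, D1 and NE2/3/4.

THE POINT (README `HOME/b2b-balaban-beta-d4-p2/g91/README.md` §2).  Uses (E102b) `old_pair_letters_split`, `own_const_mono`, (E102a) `old_pair_box_two` BY NAME
(the pure box already carries the floor `j₀` as a parameter).  NOT CLAIMED: a cap (sequel); anything printed — NOT B12 Thm 2, NOT BetaPertH, NOT continuum,
NOT Clay.

WHAT IS PROVED ([folklore]; 0 `def`, 0 sorry).  **`young_pair_leaf`**.
-/
noncomputable section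
open Finset

namespace Summit.QuantumFields.BalabanUV.Beta.EriceRemainderEnclosureHistoryAutonomyComparisonAgeCompositionYoungPairLeaf

open Literature.MathematicalPhysics.QuantumFieldTheory.Balaban1983to89
open Literature.MathematicalPhysics.QuantumFieldTheory.Balaban1983to89.T4BetaStationary
open Literature.MathematicalPhysics.QuantumFieldTheory.Balaban1983to89.T4BetaFlowWellPosed
open Summit.QuantumFields.BalabanUV.Beta.EriceRemainderEnclosureHistoryAutonomyComparisonAgeCompositionOldPairLettersSplit (own_const_mono old_pair_letters_split)
open Summit.QuantumFields.BalabanUV.Beta.EriceRemainderEnclosureHistoryAutonomyComparisonAgeCompositionDeficitProduct (old_pair_box_two)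

variable {B : (ℕ → ℝ) → ℝ} {γ b gIR : ℝ} {L : ℕ → ℝ} {K : ℕ} {h : ℕ → ℝ}

set_option maxHeartbeats 400000 in
/-- **THE PAIR-CAP LEAF WITH A FREE AGE FLOOR.**  `B` an isotone memory with floor `b > 0` dominating `L ≥ 0`, `h` a box solution, ages `j₀ ≤ j < k < K`
(`j₀ ≥ 1`) in the span box `F₁·j ≤ k ≤ F₂·j` with level ratio `σ = h_{m+j}∕h_{m+k}` in `[σ₁, σ₂]` (the top box may give `F₂ ≤ σ₂²` instead, since `σ²j ≤ k`),
an own-window constant `c` with `c²(3j₀+1) ≤ 2j₀`, and rational data `(θ, θlo, c_T, c_b, V, Alo, Blo)` passing the side conditions: `0 < σ₁`, `0 < σ₂`,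
`0 ≤ θlo ≤ θ`, `θlo = 0 ∨ θlo·j₀ + 1 ≤ θ·j₀` (split granularity), `θ + 1 ≤ F₁`, `0 ≤ c_T`, `c_T²(2+θ+1∕j₀) ≤ 2`, `0 ≤ c_b`, `c_b²(2F₁+(j₀+1)∕j₀) ≤ 2F₁`,
`0 < V`, `1∕V < 2c`, `Alo ≤ 2c_Tθlo∕σ₂² + 2(F₁−1−θ+c_b)∕σ₂³`, `Alo ≤ 1∕V`, `0 ≤ Blo ≤ 2c_bσ₁²∕F₂`, `Blo ≤ 1∕V`, `(1∕V − Alo)(1∕V − Blo) ≤ (2c − 1∕V)²`.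
THEN `x_j(m) + x_k(m) ≤ V`: `T = ⌊θj⌋`, (E102b) `old_pair_letters_split`, (E102a) `old_pair_box_two`. [folklore] -/
theorem young_pair_leaf (hmono : ∀ u v : ℕ → ℝ, SeqBox γ u → SeqBox γ v → (∀ j, u j ≤ v j) → B u ≤ B v)
    (hL : ∀ k, 0 ≤ L k) (hb : 0 < b) (hlo : ∀ u, SeqBox γ u → b ≤ B u) (hdom : ∀ u, SeqBox γ u → ∑ k ∈ range K, L k * u k ≤ B u)
    (hh : SeqBox γ h) (hf : MemFlow B gIR h) {j₀ j k : ℕ} (hj₀ : 1 ≤ j₀) (hj0 : j₀ ≤ j) (hjk : j < k) (hkK : k < K) (m : ℕ)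
    {c F₁ F₂ σ₁ σ₂ θ θlo cT cb V Alo Blo : ℝ} (hc : c ^ 2 * (3 * (j₀ : ℝ) + 1) ≤ 2 * j₀) (hk1 : F₁ * j ≤ k) (hk2 : (k : ℝ) ≤ F₂ * j)
    (hσ1 : σ₁ ≤ h (m + j) / h (m + k)) (hσ2 : h (m + j) / h (m + k) ≤ σ₂ ∨ F₂ ≤ σ₂ ^ 2)
    (hsplit : θlo = 0 ∨ θlo * j₀ + 1 ≤ θ * j₀)
    (hnum : 0 < σ₁ ∧ 0 < σ₂ ∧ 0 ≤ θlo ∧ θlo ≤ θ ∧ θ + 1 ≤ F₁ ∧ 0 ≤ cT ∧ cT ^ 2 * (2 + θ + 1 / j₀) ≤ 2 ∧ 0 ≤ cb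
      ∧ cb ^ 2 * (2 * F₁ + ((j₀ : ℝ) + 1) / j₀) ≤ 2 * F₁ ∧ 0 < V ∧ 1 / V < 2 * c
      ∧ Alo ≤ 2 * cT * θlo / σ₂ ^ 2 + 2 * (F₁ - 1 - θ + cb) / σ₂ ^ 3 ∧ Alo ≤ 1 / V ∧ 0 ≤ Blo ∧ Blo ≤ 2 * cb * σ₁ ^ 2 / F₂
      ∧ Blo ≤ 1 / V ∧ (1 / V - Alo) * (1 / V - Blo) ≤ (2 * c - 1 / V) ^ 2) :
    (j : ℝ) * (L j * h (m + j) ^ 3 / 2) + (k : ℝ) * (L k * h (m + k) ^ 3 / 2) ≤ V := by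
  obtain ⟨hσ₁, hσ₂, hθlo, hθle, hθF, hcT0, hcT, hcb0, hcb, hV, hκ, hAlo, hAV, hB0, hBlo, hBV, hprod⟩ := hnum
  have hpos : ∀ n, 0 < h n := fun n => (hh n).1
  have hj0r : (j₀ : ℝ) ≤ j := by exact_mod_cast hj0
  have hj₀r : (1 : ℝ) ≤ j₀ := by exact_mod_cast hj₀
  have hj₀pos : (0 : ℝ) < j₀ := by linarith
  have hjpos : (0 : ℝ) < j := by linarith
  have hj1 : 1 ≤ j := le_trans hj₀ hj0
  have hkr : (j : ℝ) + 1 ≤ k := by exact_mod_cast hjk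
  have hc' : c ^ 2 * (3 * (j : ℝ) + 1) ≤ 2 * j := own_const_mono hj₀ hj0 hc
  have hθ0 : 0 ≤ θ := le_trans hθlo hθle
  have hθj : 0 ≤ θ * j := by positivity
  -- the split length T = ⌊θj⌋
  obtain ⟨T, hT⟩ : ∃ T : ℕ, T = ⌊θ * (j : ℝ)⌋₊ := ⟨_, rfl⟩
  have hTle : (T : ℝ) ≤ θ * j := by rw [hT]; exact Nat.floor_le hθj
  have hTgt : θ * j < (T : ℝ) + 1 := by rw [hT]; exact Nat.lt_floor_add_one _
  have hTlo : θlo * j ≤ T := by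
    rcases hsplit with h0 | h1
    · rw [h0, zero_mul]; exact Nat.cast_nonneg _
    · have hd : 1 ≤ (θ - θlo) * j₀ := by nlinarith
      have hd0 : 0 ≤ θ - θlo := by linarith
      have : 1 ≤ (θ - θlo) * j := le_trans hd (mul_le_mul_of_nonneg_left hj0r hd0)
      linarith
  have hTk : T + j ≤ k := by
    have : (T : ℝ) + j ≤ k := by nlinarith
    exact_mod_cast this
  have hcT' : cT ^ 2 * (2 * (j : ℝ) + T + 1) ≤ 2 * j := by
    have hjj : 1 ≤ (j : ℝ) * (1 / j₀) := by rw [mul_one_div, le_div_iff₀ hj₀pos, one_mul]; exact hj0r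
    have h1 : 2 * (j : ℝ) + T + 1 ≤ j * (2 + θ + 1 / j₀) := by nlinarith
    calc cT ^ 2 * (2 * (j : ℝ) + T + 1) ≤ cT ^ 2 * (j * (2 + θ + 1 / j₀)) := mul_le_mul_of_nonneg_left h1 (sq_nonneg _)
      _ = j * (cT ^ 2 * (2 + θ + 1 / j₀)) := by ring
      _ ≤ j * 2 := mul_le_mul_of_nonneg_left hcT hjpos.le
      _ = 2 * j := by ring
  have hcb' : cb ^ 2 * (2 * (k : ℝ) + j + 1) ≤ 2 * k := by
    have hF1pos : 0 < F₁ := by linarith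
    have hkF : (j : ℝ) ≤ k / F₁ := by rw [le_div_iff₀ hF1pos]; linarith
    have hkF0 : 0 ≤ (k : ℝ) / F₁ := le_trans hjpos.le hkF
    have hrat : (j : ℝ) + 1 ≤ ((j₀ : ℝ) + 1) / j₀ * j := by
      rw [div_mul_eq_mul_div, le_div_iff₀ hj₀pos]; nlinarith
    have hrat' : (j : ℝ) + 1 ≤ ((j₀ : ℝ) + 1) / j₀ * (k / F₁) :=
      le_trans hrat (mul_le_mul_of_nonneg_left hkF (by positivity))
    have h1 : 2 * (k : ℝ) + j + 1 ≤ k / F₁ * (2 * F₁ + ((j₀ : ℝ) + 1) / j₀) := by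
      have e : k / F₁ * (2 * F₁ + ((j₀ : ℝ) + 1) / j₀) = 2 * k + ((j₀ : ℝ) + 1) / j₀ * (k / F₁) := by field_simp
      rw [e]; linarith
    calc cb ^ 2 * (2 * (k : ℝ) + j + 1) ≤ cb ^ 2 * (k / F₁ * (2 * F₁ + ((j₀ : ℝ) + 1) / j₀)) := mul_le_mul_of_nonneg_left h1 (sq_nonneg _)
      _ = k / F₁ * (cb ^ 2 * (2 * F₁ + ((j₀ : ℝ) + 1) / j₀)) := by ring
      _ ≤ k / F₁ * (2 * F₁) := mul_le_mul_of_nonneg_left hcb hkF0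
      _ = 2 * k := by field_simp
  obtain ⟨hs1, hs2, hK, hJ⟩ := old_pair_letters_split hmono hL hb hlo hdom hh hf hj1 hjk hkK hTk hc' hcT' hcb' m
  have hσ0 : 0 < h (m + j) / h (m + k) := lt_of_lt_of_le one_pos hs1
  have hσ2' : h (m + j) / h (m + k) ≤ σ₂ := by
    rcases hσ2 with h2 | h2
    · exact h2
    · have h3 : (h (m + j) / h (m + k)) ^ 2 * j ≤ σ₂ ^ 2 * j :=
        le_trans hs2 (le_trans hk2 (mul_le_mul_of_nonneg_right h2 hjpos.le))
      exact (pow_le_pow_iff_left₀ hσ0.le hσ₂.le two_ne_zero).mp (le_of_mul_le_mul_right h3 hjpos)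
  have hx : 0 ≤ (j : ℝ) * (L j * h (m + j) ^ 3 / 2) := by have := hL j; have := hpos (m + j); positivity
  have hy : 0 ≤ (k : ℝ) * (L k * h (m + k) ^ 3 / 2) := by have := hL k; have := hpos (m + k); positivity
  exact old_pair_box_two hx hy hj₀pos hj0r hk1 hk2 hσ1 hσ2' hσ₁ hTlo hTle hcT0 hcb0 hθlo hθF hK hJ hV hκ
    hAlo hAV hBlo hB0 hBV hprod

end Summit.QuantumFields.BalabanUV.Beta.EriceRemainderEnclosureHistoryAutonomyComparisonAgeCompositionYoungPairLeaf

end
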